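import Summits.ResolutionOfSingularities.ResolutionOfSingularities.Theorems.PurelyInseparableDim4ResConeLightPairTailFourFive
import Summits.ResolutionOfSingularities.ResolutionOfSingularities.Theorems.PurelyInseparableDim4ResConeLightTailFourFive
import HarnessLib
import HarnessLib.Audit.Tags

/-!
# Purely inseparable four-folds — the C∞ ASSEMBLY at `p = 5`, `d = 4`, LAYER 2a: K2(5) modulo the two-slot killer
# and the C∞ killer, both BY VALUE in the chain dress (K2(p) lane, slice B, brick K24c; cell `res-dim4-pi`)

[OURS · counted 0 · cell `res-dim4-pi` · K2(p) lane holder res-dim4-p-12 g3's brick (K24c) «THE C∞ ASSEMBLY» by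
signature (bus 2026-08-29 02:16Z / 02:23Z), seat res-dim4-p-3 g3.]  Pure logic over res-dim4-p-2 g4's K28d
`no_light_powerCone_tail_four_five_of` and res-dim4-p-3's K27b / K24c layer 1; NOTHING here proves K2(5), K2(p),
`NoIsolatedTrap p p` or resolution of singularities in dimension ≥ 4 / characteristic `p`.  AI kernel work, weaker
than expert review.

K28d reduces the light `d = 4` (C∞) tail at `p = 5` to ONE hypothesis `hγ` in the chain dress: «weights `(1, 1)` from
`k₀` and both boundary letters stretch-born from some `k₁ ≥ k₀` is contradictory».  This file quantifies that
hypothesis over all chains (`hγC`, res-dim4-p-5 / res-dim4-typ-1's `stub_γC` binder block with the chain block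
prefixed — the statement the K24b FRAME (F1–F3) and the K24b-α GAME `CInfGame.no_infinite_play` discharge, layer 2b)
and draws the two consequences the lane's ledger wants:
* **`no_light_pair_tail_four_five_of_cInf (hγC)`** — no `d = 4` light power-cone trap over any field of
  characteristic 5 (K28d at `k₀ = 0`; the trap's `(6,6)`-recurrence clause is not even used);
* **`eventuallyConst_chart_four_five_of_cInf (hγC)`** — layer 1's constancy hypothesis `hConst`, vacuously;
* **`noAboveFloorTrap_five_iff_residual_two_of_cInf (hT2) (hγC)`** — modulo the two-slot killer `hT2` (K24a) and
  the C∞ killer `hγC` (K24b): **K2(5) ⟺ (no `d = 2` light power-cone trap) ∧ (no binary-cone trap)**.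
bears_on: LADDER-RESOLUTION:D157-DOOR2 (res-dim4-pi · K2(p) · slice B · K24c layer 2a).  Supports
stmt-ResolutionOfSingularities-16155 (helper).
-/

set_option linter.dupNamespace false -- mandated namespace of this single-conjunct summit

noncomputable section

namespace Summit.ResolutionOfSingularities.ResolutionOfSingularities.Theorems.PIDim4

namespace ResCone

open MvPolynomial
open Literature.AlgebraicGeometry.Resolution
open Literature.AlgebraicGeometry.Resolution.CentreBlowup
open Literature.AlgebraicGeometry.Resolution.Hauser2010
open Literature.AlgebraicGeometry.Resolution.HauserPerlega2019
open RidgeBudget (NoAboveFloorTrap)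

/-- **NO `d = 4` LIGHT POWER-CONE TRAP AT `p = 5`, MODULO THE C∞ KILLER** (brick K24c, layer 2a): if on every
witnessed isolated above-floor `Step0 5` chain of constant shade `4` and `e_G ≡ 3` from `k₀` the C∞ configuration —
weights `(1, 1)` from `k₀`, every boundary letter stretch-born and kept from some `k₁ ≥ k₀` — is contradictory
(`hγC`, the K24b frame + game by value), then no `d = 4` light power-cone trap exists over any field of
characteristic 5 (res-dim4-p-2 g4's K28d `no_light_powerCone_tail_four_five_of` at `k₀ = 0`). [OURS · bookkeeping]
[cite: CossartJannsenSaito2020, Thm. 3.10(4), Thm. 3.14] -/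
theorem no_light_pair_tail_four_five_of_cInf
    (hγC : ∀ (K : Type) [Field K] [CharP K 5] [DecidableEq K] (c : ℕ → State K) (j : ℕ → Fin 4)
      (b : ℕ → Fin 4 → K), (∀ k, IsIsolated 5 (c k).F ∧ Step0 5 (c k) (c (k + 1))) →
      FreeTail.IsWitnessedChain 5 c j b → (∀ e ∈ (c 0).F.support, (c 0).r ≤ e) →
      (∀ k, ordZero (c k).F ≠ (5 : ℕ)) → ∀ k₀ : ℕ, (∀ k, k₀ ≤ k → (c k).shade = ((4 : ℕ) : ℕ∞)) →
      (∀ k, k₀ ≤ k → Module.finrank K (resVertex (c k)) = 3) →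
      ∀ k₁ : ℕ, k₀ ≤ k₁ → (∀ k, k₀ ≤ k → (∀ i, (c k).r i ≤ 1) ∧ (c k).r.degree = 2) →
      (∀ k, k₁ ≤ k → ∀ i, 1 ≤ (c k).r i →
        ∃ t, k₀ ≤ t ∧ t < k ∧ j t = i ∧ ∀ m, t < m → m < k → j m ≠ i ∧ b m i = 0) → False)
    (K : Type) [Field K] [CharP K 5] [DecidableEq K] :
    ¬ ∃ (c : ℕ → State K) (j : ℕ → Fin 4) (b : ℕ → Fin 4 → K),
        (∀ e' ∈ (c 0).F.support, (c 0).r ≤ e') ∧ FreeTail.IsWitnessedChain 5 c j b ∧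
        (∀ k, IsIsolated 5 (c k).F ∧ Step0 5 (c k) (c (k + 1)) ∧ ordZero (c k).F ≠ (5 : ℕ) ∧
          (c k).shade = ((4 : ℕ) : ℕ∞) ∧ Module.finrank K (resVertex (c k)) = 3) ∧
        ∀ N, ∃ k, N ≤ k ∧ FreeTail.IsSatellite j b k ∧
          ordZero (c k).F = (6 : ℕ) ∧ ordZero (c (k + 1)).F = (6 : ℕ) := by
  rintro ⟨c, j, b, hr0, hw, hc, -⟩
  exact no_light_powerCone_tail_four_five_of (k₀ := 0) (fun k => ⟨(hc k).1, (hc k).2.1⟩) hw hr0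
    (fun k => (hc k).2.2.1) (fun k _ => (hc k).2.2.2.1) (fun k _ => (hc k).2.2.2.2)
    (fun k₁ hk₁ hwt hborn => hγC K c j b (fun k => ⟨(hc k).1, (hc k).2.1⟩) hw hr0 (fun k => (hc k).2.2.1) 0
      (fun k _ => (hc k).2.2.2.1) (fun k _ => (hc k).2.2.2.2) k₁ hk₁ hwt hborn)

/-- Layer 1's constancy hypothesis `hConst` follows (vacuously) from the C∞ killer `hγC`: a constant-shade-`4`,
`e_G ≡ 3` chain does not exist at all (K28d), so in particular its chart letter is eventually constant.
[OURS · bookkeeping] [folklore] -/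
theorem eventuallyConst_chart_four_five_of_cInf
    (hγC : ∀ (K : Type) [Field K] [CharP K 5] [DecidableEq K] (c : ℕ → State K) (j : ℕ → Fin 4)
      (b : ℕ → Fin 4 → K), (∀ k, IsIsolated 5 (c k).F ∧ Step0 5 (c k) (c (k + 1))) →
      FreeTail.IsWitnessedChain 5 c j b → (∀ e ∈ (c 0).F.support, (c 0).r ≤ e) →
      (∀ k, ordZero (c k).F ≠ (5 : ℕ)) → ∀ k₀ : ℕ, (∀ k, k₀ ≤ k → (c k).shade = ((4 : ℕ) : ℕ∞)) →
      (∀ k, k₀ ≤ k → Module.finrank K (resVertex (c k)) = 3) →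
      ∀ k₁ : ℕ, k₀ ≤ k₁ → (∀ k, k₀ ≤ k → (∀ i, (c k).r i ≤ 1) ∧ (c k).r.degree = 2) →
      (∀ k, k₁ ≤ k → ∀ i, 1 ≤ (c k).r i →
        ∃ t, k₀ ≤ t ∧ t < k ∧ j t = i ∧ ∀ m, t < m → m < k → j m ≠ i ∧ b m i = 0) → False)
    (K : Type) [Field K] [CharP K 5] [DecidableEq K] (c : ℕ → State K) (j : ℕ → Fin 4) (b : ℕ → Fin 4 → K)
    (hc : ∀ k, IsIsolated 5 (c k).F ∧ Step0 5 (c k) (c (k + 1))) (hw : FreeTail.IsWitnessedChain 5 c j b)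
    (hr0 : ∀ e ∈ (c 0).F.support, (c 0).r ≤ e) (hfloor : ∀ k, ordZero (c k).F ≠ (5 : ℕ))
    (hshade : ∀ k, (c k).shade = ((4 : ℕ) : ℕ∞)) (he3 : ∀ k, Module.finrank K (resVertex (c k)) = 3) :
    ∃ k₂, ∀ k, k₂ ≤ k → j (k + 1) = j k :=
  (no_light_powerCone_tail_four_five_of (k₀ := 0) hc hw hr0 hfloor (fun k _ => hshade k) (fun k _ => he3 k)
    (fun k₁ hk₁ hwt hborn => hγC K c j b hc hw hr0 hfloor 0 (fun k _ => hshade k) (fun k _ => he3 k) k₁ hk₁ hwt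
      hborn)).elim

/-- **K2(5) ⟺ (no `d = 2` light power-cone trap) ∧ (no binary-cone trap)** — the holder's slice-B END-STATE
sentence at `p = 5`, MODULO the two-slot killer `hT2` (res-dim4-p-1 g3's K24a, in K27a's dress) and the C∞ killer
`hγC` (the K24b frame F1–F3 + the K24b-α game, in K28d's dress), both quantified over all chains.  Composition of
layer 1's `noAboveFloorTrap_five_iff_residual_two_of` with `eventuallyConst_chart_four_five_of_cInf`.
[OURS · bookkeeping] [cite: CossartJannsenSaito2020, Thm. 3.14] -/
theorem noAboveFloorTrap_five_iff_residual_two_of_cInf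
    (hT2 : ∀ (K : Type) [Field K] [CharP K 5] [DecidableEq K] (c : ℕ → State K) (j : ℕ → Fin 4)
      (b : ℕ → Fin 4 → K), (∀ k, IsIsolated 5 (c k).F ∧ Step0 5 (c k) (c (k + 1))) →
      FreeTail.IsWitnessedChain 5 c j b → (∀ e ∈ (c 0).F.support, (c 0).r ≤ e) →
      (∀ k, ordZero (c k).F ≠ (5 : ℕ)) → ∀ k₀ : ℕ, (∀ k, k₀ ≤ k → (c k).shade = ((3 : ℕ) : ℕ∞)) →
      (∀ k, k₀ ≤ k → Module.finrank K (resVertex (c k)) = 3) →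
      ∀ (ν : Fin 4) (k₁ : ℕ), k₀ ≤ k₁ → (∀ k, k₁ ≤ k → 1 ≤ (c k).r ν ∧ j k ≠ ν ∧ b k ν = 0) →
      (∀ k, k₁ ≤ k → ∀ i, i ≠ ν → 1 ≤ (c k).r i →
        ∃ t, k₀ ≤ t ∧ t < k ∧ j t = i ∧ ∀ m, t < m → m < k → j m ≠ i ∧ b m i = 0) → False)
    (hγC : ∀ (K : Type) [Field K] [CharP K 5] [DecidableEq K] (c : ℕ → State K) (j : ℕ → Fin 4)
      (b : ℕ → Fin 4 → K), (∀ k, IsIsolated 5 (c k).F ∧ Step0 5 (c k) (c (k + 1))) →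
      FreeTail.IsWitnessedChain 5 c j b → (∀ e ∈ (c 0).F.support, (c 0).r ≤ e) →
      (∀ k, ordZero (c k).F ≠ (5 : ℕ)) → ∀ k₀ : ℕ, (∀ k, k₀ ≤ k → (c k).shade = ((4 : ℕ) : ℕ∞)) →
      (∀ k, k₀ ≤ k → Module.finrank K (resVertex (c k)) = 3) →
      ∀ k₁ : ℕ, k₀ ≤ k₁ → (∀ k, k₀ ≤ k → (∀ i, (c k).r i ≤ 1) ∧ (c k).r.degree = 2) →
      (∀ k, k₁ ≤ k → ∀ i, 1 ≤ (c k).r i →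
        ∃ t, k₀ ≤ t ∧ t < k ∧ j t = i ∧ ∀ m, t < m → m < k → j m ≠ i ∧ b m i = 0) → False) :
    NoAboveFloorTrap 5 5 ↔ ∀ (K : Type) [Field K] [CharP K 5] [DecidableEq K],
      (¬ ∃ (c : ℕ → State K) (j : ℕ → Fin 4) (b : ℕ → Fin 4 → K),
          (∀ e' ∈ (c 0).F.support, (c 0).r ≤ e') ∧ FreeTail.IsWitnessedChain 5 c j b ∧
          (∀ k, IsIsolated 5 (c k).F ∧ Step0 5 (c k) (c (k + 1)) ∧ ordZero (c k).F ≠ (5 : ℕ) ∧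
            (c k).shade = ((2 : ℕ) : ℕ∞) ∧ Module.finrank K (resVertex (c k)) = 3) ∧
          ∀ N, ∃ k, N ≤ k ∧ FreeTail.IsSatellite j b k ∧
            ordZero (c k).F = (6 : ℕ) ∧ ordZero (c (k + 1)).F = (6 : ℕ)) ∧
      (¬ ∃ (c : ℕ → State K) (d : ℕ), 2 ≤ d ∧ d ≤ 4 ∧
          (∀ e' ∈ (c 0).F.support, (c 0).r ≤ e') ∧
          ∀ k, IsIsolated 5 (c k).F ∧ Step0 5 (c k) (c (k + 1)) ∧ ordZero (c k).F ≠ (5 : ℕ) ∧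
            (c k).shade = (d : ℕ∞) ∧ Module.finrank K (resVertex (c k)) = 2) :=
  noAboveFloorTrap_five_iff_residual_two_of hT2 (eventuallyConst_chart_four_five_of_cInf hγC)

end ResCone

end Summit.ResolutionOfSingularities.ResolutionOfSingularities.Theorems.PIDim4

end
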